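import Literature.NumberTheory.LFunctions.AutomaticSequencePowTransducer4
import HarnessLib

/-!
# The transducer of a sub-automaton of the power automaton: `d = k₀ = 1` (Müllner 2017, Prop. 2.25 for the final components; proved)

Everything in this file is PROVED. This is the form of Prop. 2.25 of C. Müllner, *Automatic
sequences fulfill the Sarnak conjecture* (Duke Math. J. 166 (2017)) needed by the reduction:
Müllner passes to the `p`-th power automaton and then to its FINAL COMPONENTS `A_i`, asserting
`d(A_i) = k₀(A_i) = 1` ("by the construction … we see easily"). We prove, for ANY sub-automaton of
the power automaton — the restriction `δ_S` of `digitRestrict (k^p) (powδ k p δ)` to a closed set of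
states `S` — that

* `transducerPeriod_sub_powK_eq_one` — `d(δ_S) = 1` as soon as `d(A) ∣ p`, and
* `transducerK0_sub_powK_eq_one` — `k₀(δ_S) = 1` as soon as moreover `d(A) k₀(A) ∣ p`,

where `d(A), k₀(A)` are the invariants of the naturally induced transducer of the WHOLE base-`k`
automaton `δ` (letters `≥ k` trivial; no strong connectivity is needed anywhere, so a single
`p = d(A) k₀(A)` serves all final components at once — a slight simplification of Müllner's
`p = lcm_i d(Ā_i) k₀(Ā_i)`).

Mechanism (`MinImage.isIdLoop_iff_forall_wordAct_eq`: an identity loop is a word fixing the image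
pointwise): choose a minimal image `X` of `δ_S` inside a minimal image `M` of `δ`
(`exists_minImage_sub_powK_subset`); every identity loop of `δ` at `M` of `k`-length `pL` is, read
in blocks, an identity loop of `δ_S` at `X` of length `L` (`isIdLoop_sub_powK_of_isIdLoop`). Hence
all large lengths are loop lengths (`d = 1`), the numbers of these loops contain those of `δ`
(`pathVals_subset_sub_powK`), so `d'(δ_S) ∣ d'(A)` (`transducerDPrime_sub_powK_dvd`, with
Lemma 2.18), and their residues are `(pL/d) • a = 0` (`k₀ = 1`).

## References
* C. Müllner, Duke Math. J. 166 (2017), Prop. 2.25 (proof). [Mullner2017]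
-/

noncomputable section

open Finset

namespace Literature.NumberTheory.LFunctions

namespace MinImage

variable {σ : Type*} [Fintype σ] [DecidableEq σ]

/-- **An identity loop is a word fixing the image pointwise.** [folklore] -/
theorem isIdLoop_iff_forall_wordAct_eq {δ : σ → ℕ → σ} (M : MinImage δ) (w : List ℕ) :
    M.IsIdLoop w ↔ ∀ x ∈ M.1, wordAct δ w x = x := by
  constructor
  · rintro ⟨hn, hT⟩ x hx
    have hx' : x ∈ (M.next w).1 := by rw [hn]; exact hx
    have h := M.wordAct_eq w ⟨x, hx⟩
    rw [hT, Equiv.Perm.one_apply, enum_congr hn.symm x hx hx', Equiv.symm_apply_apply] at h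
    exact h
  · intro h
    have hn : M.next w = M := by
      apply Subtype.ext
      rw [coe_next]
      conv_rhs => rw [← image_id (s := M.1)]
      exact image_congr fun x hx => h x hx
    refine ⟨hn, ?_⟩
    ext i
    obtain ⟨x, rfl⟩ := M.enum.surjective i
    have hx' : (x : σ) ∈ (M.next w).1 := by rw [hn]; exact x.2
    rw [Equiv.Perm.one_apply, T_apply_enum]
    have hval : ((M.actEquiv w x : ↥(M.next w).1) : σ) = x := by rw [coe_actEquiv]; exact h x x.2
    have h1 : M.actEquiv w x = ⟨(x : σ), hx'⟩ := Subtype.ext hval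
    rw [h1, ← enum_congr hn.symm (x : σ) x.2 hx']

end MinImage

section SubPow

variable {σ : Type*} [Fintype σ] [DecidableEq σ] {k p : ℕ}

omit [Fintype σ] [DecidableEq σ] in
/-- The restricted sub-automaton acts through `δ` on blocks. [folklore] -/
theorem coe_wordAct_sub_powK (k p : ℕ) (δ : σ → ℕ → σ) (S : Finset σ)
    (hS : ∀ q ∈ S, ∀ d : ℕ, digitRestrict (k ^ p) (powδ k p δ) q d ∈ S) {W : List ℕ}
    (hW : ∀ D ∈ W, D < k ^ p) (x : ↥S) :
    ((wordAct (restrictδ (digitRestrict (k ^ p) (powδ k p δ)) S hS) W x : ↥S) : σ) =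
      wordAct δ (W.map (msbBlock k p)).flatten x := by
  rw [coe_wordAct_restrictδ, wordAct_powK k p δ hW]

omit [Fintype σ] [DecidableEq σ] in
/-- Letters `≥ k^p` act trivially on the sub-automaton. [folklore] -/
theorem sub_powK_trivial (k p : ℕ) (δ : σ → ℕ → σ) (S : Finset σ)
    (hS : ∀ q ∈ S, ∀ d : ℕ, digitRestrict (k ^ p) (powδ k p δ) q d ∈ S) :
    ∀ (q : ↥S) (d : ℕ), k ^ p ≤ d → restrictδ (digitRestrict (k ^ p) (powδ k p δ)) S hS q d = q :=
  fun q _ hd => restrictδ_digitRestrict_of_le _ S hS q hd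

/-- **Identity loops of `δ` induce identity loops of the sub-automaton**: if `X ⊆ M` and the block
word of `W` fixes `M` pointwise, then `W` is an identity loop at `X`. [cite: Mullner2017, Prop. 2.25 (proof)] -/
theorem isIdLoop_sub_powK_of_isIdLoop (k p : ℕ) (δ : σ → ℕ → σ) (S : Finset σ)
    (hS : ∀ q ∈ S, ∀ d : ℕ, digitRestrict (k ^ p) (powδ k p δ) q d ∈ S)
    {X : MinImage (restrictδ (digitRestrict (k ^ p) (powδ k p δ)) S hS)} {M : MinImage δ}
    (hXM : ∀ x ∈ X.1, (x : σ) ∈ M.1) {W : List ℕ} (hW : ∀ D ∈ W, D < k ^ p)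
    (hloop : M.IsIdLoop (W.map (msbBlock k p)).flatten) : X.IsIdLoop W := by
  rw [MinImage.isIdLoop_iff_forall_wordAct_eq] at hloop ⊢
  intro x hx
  apply Subtype.ext
  rw [coe_wordAct_sub_powK k p δ S hS hW]
  exact hloop x (hXM x hx)

/-- **A minimal image of the sub-automaton inside a minimal image of `δ`.** [cite: Mullner2017, Prop. 2.25 (proof)] -/
theorem exists_minImage_sub_powK_subset (hk : 2 ≤ k) (hp : 0 < p) (δ : σ → ℕ → σ)
    (htriv : ∀ q d, k ≤ d → δ q d = q) (S : Finset σ)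
    (hS : ∀ q ∈ S, ∀ d : ℕ, digitRestrict (k ^ p) (powδ k p δ) q d ∈ S) :
    ∃ (X : MinImage (restrictδ (digitRestrict (k ^ p) (powδ k p δ)) S hS)) (M : MinImage δ),
      ∀ x ∈ X.1, (x : σ) ∈ M.1 := by
  have hk1 : 1 < k := hk
  set δS := restrictδ (digitRestrict (k ^ p) (powδ k p δ)) S hS with hδS
  have htrivS := sub_powK_trivial k p δ S hS
  -- a minimising `K`-digit word of the sub-automaton
  obtain ⟨W₂', h₂'⟩ := exists_card_fullImage_eq_minRank δS
  set W₂ := W₂'.filter (· < k ^ p) with hW₂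
  have hW₂d : ∀ D ∈ W₂, D < k ^ p := fun D hD => mem_filter_lt hD
  have h₂ : (fullImage δS W₂).card = minRank δS := by
    rw [hW₂, MinImage.fullImage_filter htrivS]; exact h₂'
  -- a minimising digit word of `δ`, padded to a length divisible by `p`, in blocks
  obtain ⟨w₁', h₁'⟩ := exists_card_fullImage_eq_minRank δ
  set w₁ := w₁'.filter (· < k) with hw₁
  have hw₁d : ∀ d ∈ w₁, d < k := fun d hd => mem_filter_lt hd
  have h₁ : (fullImage δ w₁).card = minRank δ := by
    rw [hw₁, MinImage.fullImage_filter htriv]; exact h₁'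
  set j := (p - 1) * w₁.length with hj
  have hlen : p ∣ (List.replicate j 0 ++ w₁).length := by
    refine ⟨w₁.length, ?_⟩
    rw [List.length_append, List.length_replicate, hj, Nat.sub_mul, one_mul,
      Nat.sub_add_cancel (Nat.le_mul_of_pos_left _ hp)]
  obtain ⟨W₁, hW₁d, hW₁⟩ := exists_blocks_of_length_dvd hk1 hp _ (List.replicate j 0 ++ w₁) rfl
    (fun d hd => by
      rcases List.mem_append.1 hd with h | h
      · rw [List.eq_of_mem_replicate h]; omega
      · exact hw₁d d h) hlen
  have hM : (fullImage δ (W₁.map (msbBlock k p)).flatten).card = minRank δ := by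
    apply le_antisymm _ (minRank_le_card_fullImage δ _)
    rw [hW₁]
    exact (card_le_card (fullImage_append_subset δ _ w₁)).trans h₁.le
  -- `X = δ_S(S, W₂ W₁)`, `M = δ(σ, blocks of W₁)`
  have hX : (fullImage δS (W₂ ++ W₁)).card = minRank δS := by
    apply le_antisymm _ (minRank_le_card_fullImage δS _)
    rw [fullImage_append]
    exact card_image_le.trans h₂.le
  refine ⟨⟨fullImage δS (W₂ ++ W₁), fullImage_mem_minImages hX⟩,
    ⟨fullImage δ (W₁.map (msbBlock k p)).flatten, fullImage_mem_minImages hM⟩, fun x hx => ?_⟩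
  -- `x = δ_S(s, W₂ W₁)` for some `s ∈ S`; its value is `δ(s, blocks of W₂ W₁) ∈ δ(σ, blocks of W₁)`
  simp only [fullImage, mem_image, mem_univ, true_and] at hx
  obtain ⟨s, rfl⟩ := hx
  show ((wordAct δS (W₂ ++ W₁) s : ↥S) : σ) ∈ fullImage δ (W₁.map (msbBlock k p)).flatten
  rw [hδS, coe_wordAct_sub_powK k p δ S hS (MinImage.digits_append hW₂d hW₁d), List.map_append,
    List.flatten_append]
  exact fullImage_append_subset δ _ _ (by
    simp only [fullImage, mem_image, mem_univ, true_and]; exact ⟨_, rfl⟩)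

/-- **`d = 1` for every sub-automaton of the power automaton** when `d(A) ∣ p`.
[cite: Mullner2017, Prop. 2.25] -/
theorem transducerPeriod_sub_powK_eq_one (hk : 2 ≤ k) (hp : 0 < p) (δ : σ → ℕ → σ)
    (htriv : ∀ q d, k ≤ d → δ q d = q) (hdp : transducerPeriod k δ ∣ p) (S : Finset σ)
    (hS : ∀ q ∈ S, ∀ d : ℕ, digitRestrict (k ^ p) (powδ k p δ) q d ∈ S) :
    transducerPeriod (k ^ p) (restrictδ (digitRestrict (k ^ p) (powδ k p δ)) S hS) = 1 := by
  have hk0 : 0 < k := by omega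
  have hk1 : 1 < k := hk
  have hK0 : 0 < k ^ p := pow_pos hk0 p
  set δS := restrictδ (digitRestrict (k ^ p) (powδ k p δ)) S hS with hδS
  have htrivS := sub_powK_trivial k p δ S hS
  obtain ⟨X, M, hXM⟩ := exists_minImage_sub_powK_subset hk hp δ htriv S hS
  obtain ⟨n₀, hn₀⟩ := M.exists_mem_loopLengths_of_ge k
  have hper : M.period k ∣ p := by rw [M.period_eq_transducerPeriod hk0 htriv]; exact hdp
  have hmem : ∀ n : ℕ, n₀ ≤ n → n ∈ X.loopLengths (k ^ p) := by
    intro n hn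
    obtain ⟨w, hwd, hwl, hw⟩ := hn₀ (p * n) (hn.trans (Nat.le_mul_of_pos_left n hp))
      (hper.trans (dvd_mul_right p n))
    obtain ⟨W, hWd, rfl⟩ := exists_blocks_of_length_dvd hk1 hp _ w rfl hwd (hwl ▸ dvd_mul_right p n)
    refine ⟨W, hWd, ?_, isIdLoop_sub_powK_of_isIdLoop k p δ S hS hXM hWd hw⟩
    rw [length_flatten_map_msbBlock hk1 hWd] at hwl
    exact Nat.eq_of_mul_eq_mul_left hp hwl
  have h1 : X.period (k ^ p) ∣ n₀ + 1 := MinImage.period_dvd_of_mem (hmem _ (Nat.le_succ _))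
  have h2 : X.period (k ^ p) ∣ n₀ + 1 + 1 := MinImage.period_dvd_of_mem (hmem _ (by omega))
  have h3 : X.period (k ^ p) ∣ 1 := by
    have := Nat.dvd_sub h2 h1
    rwa [Nat.add_sub_cancel_left] at this
  rw [← X.period_eq_transducerPeriod hK0 htrivS]
  exact Nat.dvd_one.1 h3

/-- **Numbers of identity loops of `δ` are numbers of identity loops of the sub-automaton**
(`X ⊆ M`, lengths `pL ↦ L`). [cite: Mullner2017, Prop. 2.25 (proof)] -/
theorem pathVals_subset_sub_powK (hk : 2 ≤ k) (hp : 0 < p) (δ : σ → ℕ → σ) (S : Finset σ)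
    (hS : ∀ q ∈ S, ∀ d : ℕ, digitRestrict (k ^ p) (powδ k p δ) q d ∈ S)
    {X : MinImage (restrictδ (digitRestrict (k ^ p) (powδ k p δ)) S hS)} {M : MinImage δ}
    (hXM : ∀ x ∈ X.1, (x : σ) ∈ M.1) (L : ℕ) :
    M.pathVals k M 1 (p * L) ⊆ X.pathVals (k ^ p) X 1 L := by
  have hk1 : 1 < k := hk
  rintro x ⟨w, hwd, hwl, hwn, hwT, rfl⟩
  obtain ⟨W, hWd, rfl⟩ := exists_blocks_of_length_dvd hk1 hp _ w rfl hwd (hwl ▸ dvd_mul_right p L)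
  have hWl : W.length = L := by
    rw [length_flatten_map_msbBlock hk1 hWd] at hwl
    exact Nat.eq_of_mul_eq_mul_left hp hwl
  have hloop := isIdLoop_sub_powK_of_isIdLoop k p δ S hS hXM hWd ⟨hwn, hwT⟩
  exact ⟨W, hWd, hWl, hloop.1, hloop.2, wordVal_powK hk1 hWd⟩

/-- Hence the difference-gcds divide: `d_{id,L}(X) ∣ d_{id,pL}(M)`. [cite: Mullner2017, Prop. 2.25 (proof)] -/
theorem diffGcd_sub_powK_dvd (hk : 2 ≤ k) (hp : 0 < p) (δ : σ → ℕ → σ) (S : Finset σ)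
    (hS : ∀ q ∈ S, ∀ d : ℕ, digitRestrict (k ^ p) (powδ k p δ) q d ∈ S)
    {X : MinImage (restrictδ (digitRestrict (k ^ p) (powδ k p δ)) S hS)} {M : MinImage δ}
    (hXM : ∀ x ∈ X.1, (x : σ) ∈ M.1) (L : ℕ) :
    X.diffGcd (k ^ p) X 1 L ∣ M.diffGcd k M 1 (p * L) := by
  have hsub := pathVals_subset_sub_powK hk hp δ S hS hXM L
  rw [MinImage.diffGcd, MinImage.diffGcd, Nat.dvd_setGcd_iff]
  rintro z ⟨x, hx, y, hy, hyx, rfl⟩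
  exact Nat.setGcd_dvd_of_mem ⟨x, hsub hx, y, hsub hy, hyx, rfl⟩

/-- **`d'(δ_S) ∣ d'(A)`** when `d(A) ∣ p` (Lemma 2.18 for `A`). [cite: Mullner2017, Prop. 2.25 (proof)] -/
theorem transducerDPrime_sub_powK_dvd (hk : 2 ≤ k) (hp : 0 < p) (δ : σ → ℕ → σ)
    (htriv : ∀ q d, k ≤ d → δ q d = q) (hK : 2 ≤ k ^ p) (hdp : transducerPeriod k δ ∣ p)
    (S : Finset σ) (hS : ∀ q ∈ S, ∀ d : ℕ, digitRestrict (k ^ p) (powδ k p δ) q d ∈ S)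
    {X : MinImage (restrictδ (digitRestrict (k ^ p) (powδ k p δ)) S hS)} {M : MinImage δ}
    (hXM : ∀ x ∈ X.1, (x : σ) ∈ M.1) :
    transducerDPrime hK (restrictδ (digitRestrict (k ^ p) (powδ k p δ)) S hS)
        (sub_powK_trivial k p δ S hS) ∣ transducerDPrime hk δ htriv := by
  have hk0 : 0 < k := by omega
  have hK0 : 0 < k ^ p := by omega
  have htrivS := sub_powK_trivial k p δ S hS
  haveI : NeZero (transducerPeriod (k ^ p) (restrictδ (digitRestrict (k ^ p) (powδ k p δ)) S hS)) := ⟨(transducerPeriod_pos hK0 htrivS).ne'⟩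
  haveI : NeZero (transducerPeriod k δ) := ⟨(transducerPeriod_pos hk0 htriv).ne'⟩
  -- the stable values: `d(X,X) ∣ d(M,M)` on the class 0
  have hlim : X.limitDiffGcd hK htrivS X 0 ∣ M.limitDiffGcd hk htriv M 0 := by
    obtain ⟨m₁, hm₁⟩ := X.exists_forall_diffGcd_eq_limitDiffGcd hK htrivS X 0
    obtain ⟨m₂, hm₂⟩ := M.exists_forall_diffGcd_eq_limitDiffGcd hk htriv M 0
    obtain ⟨c, hc⟩ := hdp
    have hcpos : 0 < c := by
      rcases Nat.eq_zero_or_pos c with rfl | h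
      · rw [mul_zero] at hc; omega
      · exact h
    have h1X : (1 : Equiv.Perm (Fin (minRank (restrictδ (digitRestrict (k ^ p) (powδ k p δ)) S hS)))) ∈ X.pathOutputs (k ^ p) X 0 :=
      MinImage.mem_pathOutputs.2 ⟨[], by simp, by simp, X.next_nil, X.T_nil⟩
    have h1M : (1 : Equiv.Perm (Fin (minRank δ))) ∈ M.pathOutputs k M 0 :=
      MinImage.mem_pathOutputs.2 ⟨[], by simp, by simp, M.next_nil, M.T_nil⟩
    set N := max m₁ m₂ + 1 with hN
    have e1 := hm₁ 1 h1X N (by omega)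
    have e2 := hm₂ 1 h1M (c * N * transducerPeriod (k ^ p) (restrictδ (digitRestrict (k ^ p) (powδ k p δ)) S hS))
      (le_trans (by omega : m₂ ≤ N) (le_trans (Nat.le_mul_of_pos_left N hcpos)
        (Nat.le_mul_of_pos_right _ (transducerPeriod_pos hK0 htrivS))))
    rw [ZMod.val_zero, zero_add] at e1 e2
    have heq : c * N * transducerPeriod (k ^ p) (restrictδ (digitRestrict (k ^ p) (powδ k p δ)) S hS) * transducerPeriod k δ =
        p * (N * transducerPeriod (k ^ p) (restrictδ (digitRestrict (k ^ p) (powδ k p δ)) S hS)) :=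
      calc c * N * transducerPeriod (k ^ p) (restrictδ (digitRestrict (k ^ p) (powδ k p δ)) S hS) * transducerPeriod k δ
          = transducerPeriod k δ * c * (N * transducerPeriod (k ^ p) (restrictδ (digitRestrict (k ^ p) (powδ k p δ)) S hS)) := by ring
        _ = p * (N * transducerPeriod (k ^ p) (restrictδ (digitRestrict (k ^ p) (powδ k p δ)) S hS)) := by rw [← hc]
    rw [← e1, ← e2, heq]
    have key := diffGcd_sub_powK_dvd hk hp δ S hS hXM (N * transducerPeriod (k ^ p) (restrictδ (digitRestrict (k ^ p) (powδ k p δ)) S hS))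
    convert key using 3
  have hDS : transducerDPrime hK (restrictδ (digitRestrict (k ^ p) (powδ k p δ)) S hS) htrivS =
      Nat.gcd (X.limitDiffGcd hK htrivS X 0) ((k ^ p) ^ transducerPeriod (k ^ p) (restrictδ (digitRestrict (k ^ p) (powδ k p δ)) S hS) - 1) := by
    rw [← X.dPrime_eq_transducerDPrime hK htrivS X 0, MinImage.dPrime]
  have hD : transducerDPrime hk δ htriv =
      Nat.gcd (M.limitDiffGcd hk htriv M 0) (k ^ transducerPeriod k δ - 1) := by
    rw [← M.dPrime_eq_transducerDPrime hk htriv M 0, MinImage.dPrime]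
  obtain ⟨ℓ₀, hℓ₀⟩ := MinImage.exists_limitDiffGcd_dvd hk htriv (δ := δ)
  have hdvd1 : transducerDPrime hK (restrictδ (digitRestrict (k ^ p) (powδ k p δ)) S hS) htrivS ∣ k ^ ℓ₀ * (k ^ transducerPeriod k δ - 1) := by
    rw [hDS]; exact ((Nat.gcd_dvd_left _ _).trans hlim).trans (hℓ₀ M M 0)
  have hcop : Nat.Coprime (k ^ ℓ₀) (transducerDPrime hK (restrictδ (digitRestrict (k ^ p) (powδ k p δ)) S hS) htrivS) := by
    have h1 : transducerDPrime hK (restrictδ (digitRestrict (k ^ p) (powδ k p δ)) S hS) htrivS ∣ k ^ (p * transducerPeriod (k ^ p) (restrictδ (digitRestrict (k ^ p) (powδ k p δ)) S hS)) - 1 := by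
      rw [pow_mul]; exact transducerDPrime_dvd hK (restrictδ (digitRestrict (k ^ p) (powδ k p δ)) S hS) htrivS
    exact Nat.Coprime.coprime_dvd_right h1
      (coprime_pow_pow_sub_one hk0 ℓ₀ _ (Nat.mul_pos hp (transducerPeriod_pos hK0 htrivS)))
  have hdvd2 : transducerDPrime hK (restrictδ (digitRestrict (k ^ p) (powδ k p δ)) S hS) htrivS ∣ k ^ transducerPeriod k δ - 1 :=
    hcop.symm.dvd_of_dvd_mul_left hdvd1
  rw [hD]
  exact Nat.dvd_gcd (by rw [hDS]; exact (Nat.gcd_dvd_left _ _).trans hlim) hdvd2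

/-- **`k₀ = 1` for every sub-automaton of the power automaton** when `d(A) ∣ p` and
`d(A) k₀(A) ∣ p`. [cite: Mullner2017, Prop. 2.25] -/
theorem transducerK0_sub_powK_eq_one (hk : 2 ≤ k) (hp : 0 < p) (δ : σ → ℕ → σ)
    (htriv : ∀ q d, k ≤ d → δ q d = q) (hK : 2 ≤ k ^ p) (hdp : transducerPeriod k δ ∣ p)
    (hkp : transducerPeriod k δ * transducerK0 hk δ htriv ∣ p) (S : Finset σ)
    (hS : ∀ q ∈ S, ∀ d : ℕ, digitRestrict (k ^ p) (powδ k p δ) q d ∈ S) :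
    transducerK0 hK (restrictδ (digitRestrict (k ^ p) (powδ k p δ)) S hS)
      (sub_powK_trivial k p δ S hS) = 1 := by
  have hk0 : 0 < k := by omega
  have hk1 : 1 < k := hk
  have hK0 : 0 < k ^ p := by omega
  have htrivS := sub_powK_trivial k p δ S hS
  haveI : NeZero (transducerPeriod (k ^ p) (restrictδ (digitRestrict (k ^ p) (powδ k p δ)) S hS)) := ⟨(transducerPeriod_pos hK0 htrivS).ne'⟩
  haveI : NeZero (transducerPeriod k δ) := ⟨(transducerPeriod_pos hk0 htriv).ne'⟩
  obtain ⟨X, M, hXM⟩ := exists_minImage_sub_powK_subset hk hp δ htriv S hS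
  obtain ⟨c, hc⟩ := hdp
  have hcpos : 0 < c := by
    rcases Nat.eq_zero_or_pos c with rfl | h
    · rw [mul_zero] at hc; omega
    · exact h
  have hk0c : transducerK0 hk δ htriv ∣ c := by
    have : transducerPeriod k δ * transducerK0 hk δ htriv ∣ transducerPeriod k δ * c := hc ▸ hkp
    exact Nat.dvd_of_mul_dvd_mul_left (transducerPeriod_pos hk0 htriv) this
  obtain ⟨c', hc'⟩ := hk0c
  -- thresholds
  obtain ⟨msS, hmsS⟩ := MinImage.exists_uniform_stab hK htrivS (δ := (restrictδ (digitRestrict (k ^ p) (powδ k p δ)) S hS))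
  obtain ⟨mrM, hmrM⟩ := M.exists_forall_exists_loop_eq hk0 htriv
  have h1X : (1 : Equiv.Perm (Fin (minRank (restrictδ (digitRestrict (k ^ p) (powδ k p δ)) S hS)))) ∈ X.pathOutputs (k ^ p) X 0 :=
    MinImage.mem_pathOutputs.2 ⟨[], by simp, by simp, X.next_nil, X.T_nil⟩
  -- the identity-loop residues of `δ_S` at `X` vanish for large `ℓ`
  have hzero : ∀ ℓ : ℕ, max (max msS mrM) (MinImage.s0Level hk htriv (δ := δ)) ≤ ℓ →
      X.sVal hK htrivS X 1 (ℓ * transducerPeriod (k ^ p) (restrictδ (digitRestrict (k ^ p) (powδ k p δ)) S hS)) = 0 := by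
    intro ℓ hℓ
    have hℓ1 : msS ≤ ℓ := le_of_max_le_left (le_of_max_le_left hℓ)
    have hℓ2 : mrM ≤ ℓ := le_of_max_le_right (le_of_max_le_left hℓ)
    have hℓ3 : MinImage.s0Level hk htriv (δ := δ) ≤ ℓ := le_of_max_le_right hℓ
    -- an identity loop of `δ` at `M` of length `p ℓ d_S = (c ℓ d_S) d`, in blocks
    have hn : mrM ≤ c * (ℓ * transducerPeriod (k ^ p) (restrictδ (digitRestrict (k ^ p) (powδ k p δ)) S hS)) :=
      hℓ2.trans (le_trans (Nat.le_mul_of_pos_right ℓ (transducerPeriod_pos hK0 htrivS))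
        (Nat.le_mul_of_pos_left _ hcpos))
    obtain ⟨w, hwd, hwl, hwn, hwT⟩ := hmrM _ hn 1 (Subgroup.one_mem _)
    have hwl' : w.length = p * (ℓ * transducerPeriod (k ^ p) (restrictδ (digitRestrict (k ^ p) (powδ k p δ)) S hS)) := by
      rw [hwl]
      calc c * (ℓ * transducerPeriod (k ^ p) (restrictδ (digitRestrict (k ^ p) (powδ k p δ)) S hS)) * transducerPeriod k δ
          = transducerPeriod k δ * c * (ℓ * transducerPeriod (k ^ p) (restrictδ (digitRestrict (k ^ p) (powδ k p δ)) S hS)) := by ring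
        _ = p * (ℓ * transducerPeriod (k ^ p) (restrictδ (digitRestrict (k ^ p) (powδ k p δ)) S hS)) := by rw [← hc]
    obtain ⟨W, hWd, rfl⟩ := exists_blocks_of_length_dvd hk1 hp _ w rfl hwd (hwl' ▸ dvd_mul_right _ _)
    have hWl : W.length = ℓ * transducerPeriod (k ^ p) (restrictδ (digitRestrict (k ^ p) (powδ k p δ)) S hS) := by
      rw [length_flatten_map_msbBlock hk1 hWd] at hwl'
      exact Nat.eq_of_mul_eq_mul_left hp hwl'
    have hloop := isIdLoop_sub_powK_of_isIdLoop k p δ S hS hXM hWd ⟨hwn, hwT⟩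
    have hstab := hmsS X X 0 1 h1X ℓ hℓ1
    have hsv := MinImage.sVal_eq hK htrivS hstab hWd (by rw [hWl, ZMod.val_zero, zero_add])
      hloop.1 hloop.2
    rw [ZMod.val_zero, zero_add] at hsv
    rw [hsv, ZMod.natCast_eq_zero_iff]
    refine (transducerDPrime_sub_powK_dvd hk hp δ htriv hK ⟨c, hc⟩ S hS hXM).trans ?_
    rw [← ZMod.natCast_eq_zero_iff, wordVal_powK hk1 hWd]
    have hℓ' : MinImage.s0Level hk htriv (δ := δ) ≤ c * (ℓ * transducerPeriod (k ^ p) (restrictδ (digitRestrict (k ^ p) (powδ k p δ)) S hS)) :=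
      hℓ3.trans (le_trans (Nat.le_mul_of_pos_right ℓ (transducerPeriod_pos hK0 htrivS))
        (Nat.le_mul_of_pos_left _ hcpos))
    rw [M.natCast_wordVal_loop hk htriv hwd hwl hwn hℓ', hwT, MinImage.s0_one, zero_add, hc',
      show transducerK0 hk δ htriv * c' * (ℓ * transducerPeriod (k ^ p) (restrictδ (digitRestrict (k ^ p) (powδ k p δ)) S hS)) =
        (c' * (ℓ * transducerPeriod (k ^ p) (restrictδ (digitRestrict (k ^ p) (powδ k p δ)) S hS))) * transducerK0 hk δ htriv by ring,
      mul_nsmul', transducerK0_nsmul_s0Slope, nsmul_zero]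
  -- hence the common slope of `δ_S` vanishes
  have hspec := (MinImage.exists_common_slope hK htrivS (δ := (restrictδ (digitRestrict (k ^ p) (powδ k p δ)) S hS))).choose_spec.choose_spec
  set mK := (MinImage.exists_common_slope hK htrivS (δ := (restrictδ (digitRestrict (k ^ p) (powδ k p δ)) S hS))).choose with hmK
  set aK := (MinImage.exists_common_slope hK htrivS (δ := (restrictδ (digitRestrict (k ^ p) (powδ k p δ)) S hS))).choose_spec.choose with haK
  set L := max mK (max (max msS mrM) (MinImage.s0Level hk htriv (δ := δ))) with hL
  have e1 : L • aK = 0 := by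
    rw [← hspec X L (le_max_left _ _)]; exact hzero L (le_max_right _ _)
  have e2 : (L + 1) • aK = 0 := by
    rw [← hspec X (L + 1) ((le_max_left _ _).trans (Nat.le_succ _))]
    exact hzero (L + 1) ((le_max_right _ _).trans (Nat.le_succ _))
  have haK0 : aK = 0 := by rw [succ_nsmul, e1, zero_add] at e2; exact e2
  rw [transducerK0, ← haK, haK0, addOrderOf_zero]

end SubPow

end Literature.NumberTheory.LFunctions
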